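import Literature.Algebra.EuclideanLattices.KhotTablesFP
import Literature.Algebra.EuclideanLattices.KhotBCHTableFP
import HarnessLib

/-!
# Khot 2005, Thm. 1.1: the machine — the explicit output map is polynomial-time, and the target fact from PCP alone

Topic `Algebra/EuclideanLattices`, namespace `Literature.Algebra.EuclideanLattices.Khot`. This file
discharges the MACHINE hypothesis of `gapSVP_const_isNPHardRandomized_of_prop6_of_FP_explicit`
(`KhotExplicitReduction.lean`): for every number `k` of levels, some `F ∈ FP` computes
`⟨code I, c⟩ ↦ code (khotOutputExplicit k I c)` — the total output map of Khot's randomised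
reduction from gap set cover to `GapSVP` on the tree's TM2 model (§7.3: "a (randomized) reduction …
that runs in time `n^{O(k²)}`"). It is assembled in the typed algebra `CodeFP` from the pieces of
`KhotParamsFP.lean` (parameters), `KhotBCHTableFP.lean` (the BCH block), `KhotTablesFP.lean` (the base
basis, the sampled shift, the boosted/padded/squared output table), plus, here: the parse of the
input code, the guard of `khotOutput` decided on codes (`guardBit`, `guardBitFP`, `guardBit_iff`),
the coin fields (`gL`, `rL`), the row-major output code (`mainOut`, `mainOutFP`) and its agreement
with `GapSVPInstance.encode (khotMain …)` (`outE_mainOut`), and the two fixed instances. Consequence: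
**`gapSVP_const_isNPHardRandomized_of_prop6` — the target named fact follows from the PCP-based
gap set cover hardness `AroraEtAl1997_prop6` alone** (the one remaining named fact in the cone).
No new facts.

## References

* S. Khot, *Hardness of approximating the shortest vector problem in lattices*, J. ACM 52 (2005)
  789–808, Thm. 1.1, Thm. 5.1, §7.3.
* S. Arora, L. Babai, J. Stern, Z. Sweedyk, *The hardness of approximate optima in lattices, codes,
  and systems of linear equations*, JCSS 54 (1997), Prop. 6.
* S. Arora, B. Barak, *Computational Complexity: A Modern Approach*, CUP 2009, §1.3, §0.1.
-/

namespace Literature.Algebra.EuclideanLattices.Khot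

open Literature.Computability.Complexity Literature.Computability.Complexity.LMat
  Literature.Computability.Complexity.CodeFP Params _root_.Computability

/-! ### The input pairs and their codes -/

section Input

/-- An input of the reduction: a set cover instance and a coin string. [folklore] -/
abbrev In : Type := SetCoverInstance × List Bool

/-- The code of an input: `⟨code I, c⟩`. [folklore] -/
def inE : In → List Bool := fun p => boolPair (SetCoverInstance.encoding.encode p.1) p.2

/-- The typed view of an input: `((u, (sets, K)), c)`. [folklore] -/
def tupOf (p : In) : (ℕ × (List (List ℕ) × ℕ)) × List Bool := ((p.1.univSize, (p.1.sets, p.1.K)), p.2)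

/-- The typed code of an input. [folklore] -/
abbrev tE : (ℕ × (List (List ℕ) × ℕ)) × List Bool → List Bool :=
  pairE (pairE natE (pairE (listE (listE natE)) natE)) strE

/-- The instance code is the tuple code (`listBool` = `listE`, `pairBool` = `pairE`). [folklore] -/
theorem encode_eq_tE (I : SetCoverInstance) :
    SetCoverInstance.encoding.encode I = pairE natE (pairE (listE (listE natE)) natE) (I.univSize, (I.sets, I.K)) := by
  rw [encode_eq]
  have h : (encodingNatBool.listBool.listBool.encode : List (List ℕ) → List Bool) = listE (listE natE) := by
    rw [listE_eq, listE_eq]; rfl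
  rw [h]; rfl

/-- `inE = tE ∘ tupOf`. [folklore] -/
theorem inE_eq (p : In) : inE p = tE (tupOf p) := by
  rw [inE, encode_eq_tE]; rfl

/-- Reading the typed view off the code (the identity string function). [folklore] -/
theorem tupOfFP : CodeFP inE tE tupOf := (CodeFP.id inE).recodeOut inE_eq

end Input

/-! ### The guard decided on codes -/

section GuardBit

/-- **The guard as a Boolean program**: `1 ≤ K ≤ m`, `1 ≤ u`, `u ≤ T` (the total number of listed
elements) and every `e < min u T` is listed in some set. [folklore] -/
def guardBit (u : ℕ) (sets : List (List ℕ)) (K : ℕ) : Bool :=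
  decide (1 ≤ K) && decide (K ≤ sets.length) && decide (1 ≤ u) && decide (u ≤ sets.flatten.length) &&
    (List.range (min u sets.flatten.length)).all fun e => sets.any fun S => decide (e ∈ S)

/-- A covered universe is no larger than the total number of listed elements. [folklore] -/
theorem univSize_le_of_cover {I : SetCoverInstance} (hcov : ∀ e < I.univSize, ∃ j < I.sets.length, e ∈ I.subsetAt j) :
    I.univSize ≤ I.sets.flatten.length := by
  have hsub : Finset.range I.univSize ⊆ I.sets.flatten.toFinset := fun e he => by
    rw [List.mem_toFinset, List.mem_flatten]
    obtain ⟨j, hj, hej⟩ := hcov e (Finset.mem_range.1 he)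
    refine ⟨I.sets[j], List.getElem_mem hj, ?_⟩
    have h' : I.subsetAt j = I.sets[j] := by
      unfold SetCoverInstance.subsetAt
      rw [List.getD_eq_getElem?_getD, List.getElem?_eq_getElem hj, Option.getD_some]
    rwa [h'] at hej
  calc I.univSize = (Finset.range I.univSize).card := (Finset.card_range _).symm
    _ ≤ I.sets.flatten.toFinset.card := Finset.card_le_card hsub
    _ ≤ I.sets.flatten.length := List.toFinset_card_le _

/-- Listed in some `subsetAt j`, `j < m` iff listed in some member of `sets`. [folklore] -/
theorem exists_subsetAt_iff (I : SetCoverInstance) (e : ℕ) :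
    (∃ j < I.sets.length, e ∈ I.subsetAt j) ↔ ∃ S ∈ I.sets, e ∈ S := by
  constructor
  · rintro ⟨j, hj, he⟩
    refine ⟨I.sets[j], List.getElem_mem hj, ?_⟩
    unfold SetCoverInstance.subsetAt at he
    rwa [List.getD_eq_getElem?_getD, List.getElem?_eq_getElem hj, Option.getD_some] at he
  · rintro ⟨S, hS, he⟩
    obtain ⟨j, hj, rfl⟩ := List.mem_iff_getElem.1 hS
    refine ⟨j, hj, ?_⟩
    unfold SetCoverInstance.subsetAt
    rwa [List.getD_eq_getElem?_getD, List.getElem?_eq_getElem hj, Option.getD_some]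

/-- **The program decides the guard.** [folklore] -/
theorem guardBit_iff (I : SetCoverInstance) : guardBit I.univSize I.sets I.K = true ↔ Guard I := by
  unfold guardBit Guard
  simp only [Bool.and_eq_true, decide_eq_true_eq, List.all_eq_true, List.mem_range, List.any_eq_true]
  constructor
  · rintro ⟨⟨⟨⟨h1, h2⟩, h3⟩, h4⟩, h5⟩
    refine ⟨h1, h2, h3, fun e he => (exists_subsetAt_iff I e).2 ?_⟩
    obtain ⟨S, hS, heS⟩ := h5 e (by rw [min_eq_left h4]; exact he)
    exact ⟨S, hS, heS⟩
  · rintro ⟨h1, h2, h3, hcov⟩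
    have h4 := univSize_le_of_cover hcov
    refine ⟨⟨⟨⟨h1, h2⟩, h3⟩, h4⟩, fun e he => ?_⟩
    obtain ⟨S, hS, heS⟩ := (exists_subsetAt_iff I e).1 (hcov e (by rw [min_eq_left h4] at he; exact he))
    exact ⟨S, hS, heS⟩

/-- **The guard is decided on codes.** [cite: AroraBarak2009, §1.3] -/
theorem guardBitFP : CodeFP inE bitE (fun p => guardBit p.1.univSize p.1.sets p.1.K) := by
  have hT := tupOfFP
  have hu : CodeFP inE natE (fun p => p.1.univSize) := (hT.fst'.fst' :)
  have hK : CodeFP inE natE (fun p => p.1.K) := (hT.fst'.snd'.snd' :)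
  have hsets' := ((map₀ (rawOfList natE)).comp ((rawOfList (listE natE)).comp hT.fst'.snd'.fst') :)
  have hsets : CodeFP inE (rawE (rawE natE)) (fun p => p.1.sets) := hsets'.congr fun p => by simp [tupOf]
  have hm : CodeFP inE natE (fun p => p.1.sets.length) := ((natLength _).comp hsets :)
  have hTu : CodeFP inE unE (fun p => p.1.sets.flatten.length) := ((ulength natE).comp ((flatten natE).comp hsets) :)
  have hmin : CodeFP inE unE (fun p => min p.1.univSize p.1.sets.flatten.length) := (unOfNatMin.comp (hTu.pair hu) :)
  -- the covering test: `all` over `range (min u T)` with context `sets`, `any` over `sets` with context `e`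
  have hin : CodeFP (pairE natE (rawE natE)) bitE (fun t => decide (t.1 ∈ t.2)) := mem natE_injective
  have hany : CodeFP (pairE (rawE (rawE natE)) natE) bitE (fun t => t.1.any fun S => decide (t.2 ∈ S)) :=
    ((any hin).comp ((snd _ _).pair (fst _ _)) :)
  have hall : CodeFP inE bitE (fun p => (List.range (min p.1.univSize p.1.sets.flatten.length)).all fun e =>
      p.1.sets.any fun S => decide (e ∈ S)) := ((all hany).comp (hsets.pair (urange.comp hmin)) :)
  have h1 : CodeFP inE bitE (fun p => decide (1 ≤ p.1.K)) := (natLe.comp ((const _ 1).pair hK) :)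
  have h2 : CodeFP inE bitE (fun p => decide (p.1.K ≤ p.1.sets.length)) := (natLe.comp (hK.pair hm) :)
  have h3 : CodeFP inE bitE (fun p => decide (1 ≤ p.1.univSize)) := (natLe.comp ((const _ 1).pair hu) :)
  have h4 : CodeFP inE bitE (fun p => decide (p.1.univSize ≤ p.1.sets.flatten.length)) := (natLeUn.comp (hu.pair hTu) :)
  exact ((((h1.and h2).and h3).and h4).and hall).congr fun p => rfl

/-- The second test of `khotOutput`: `u = 0 ∧ 1 ≤ K ≤ m`. [folklore] -/
theorem yesBitFP : CodeFP inE bitE (fun p => decide (p.1.univSize = 0 ∧ 1 ≤ p.1.K ∧ p.1.K ≤ p.1.sets.length)) := by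
  have hT := tupOfFP
  have hu : CodeFP inE natE (fun p => p.1.univSize) := (hT.fst'.fst' :)
  have hK : CodeFP inE natE (fun p => p.1.K) := (hT.fst'.snd'.snd' :)
  have hm' := ((natLength _).comp ((rawOfList (listE natE)).comp hT.fst'.snd'.fst') :)
  have hm : CodeFP inE natE (fun p => p.1.sets.length) := hm'.congr fun p => by simp [tupOf]
  have h := ((natEq.comp (hu.pair (const _ 0))).and ((natLe.comp ((const _ 1).pair hK)).and (natLe.comp (hK.pair hm))) :)
  exact h.congr fun p => by simp [Bool.decide_and]

end GuardBit

/-! ### Inputs on the guard: the main branch as a program -/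

/-- The inputs on the guard. [folklore] -/
def GIn : Type := {p : In // Guard p.1}

namespace GIn

variable (g : GIn)

/-- The instance. [folklore] -/
abbrev I : SetCoverInstance := g.val.1
/-- The coins. [folklore] -/
abbrev c : List Bool := g.val.2
/-- The universe size `u`. [folklore] -/
abbrev u : ℕ := g.I.univSize
/-- The sets. [folklore] -/
abbrev sets : List (List ℕ) := g.I.sets
/-- The number of sets `σ = m`. [folklore] -/
abbrev σ : ℕ := g.I.sets.length
/-- The cover size `K`. [folklore] -/
abbrev K : ℕ := g.I.K
/-- The code length `n`. [folklore] -/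
abbrev n : ℕ := (SetCoverInstance.encoding.encode g.I).length

/-- `u ≥ 1` on the guard. [folklore] -/
theorem one_le_u : 1 ≤ g.u := g.property.2.2.1

/-- The size datum of an input on the guard. [folklore] -/
def pd : PDom :=
  ⟨(g.n, (g.u, (g.σ, g.K))), (guard_sizes_le g.property).2.2.2, (guard_sizes_le g.property).2.2.1,
    (guard_sizes_le g.property).1, (guard_sizes_le g.property).2.1⟩

/-- Field `n` of the size datum. [folklore] -/
@[simp] theorem pd_n : g.pd.n = g.n := rfl
/-- Field `u` of the size datum. [folklore] -/
@[simp] theorem pd_u : g.pd.u = g.u := rfl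
/-- Field `σ` of the size datum. [folklore] -/
@[simp] theorem pd_σ : g.pd.σ = g.σ := rfl
/-- Field `K` of the size datum. [folklore] -/
@[simp] theorem pd_K : g.pd.K = g.K := rfl

end GIn

/-- The code of an input on the guard (that of the input). [folklore] -/
def gE : GIn → List Bool := fun g => inE g.val

section MainProgram

variable (k : ℕ) (g : GIn)

/-- The sampled columns `g_i = ⟨block i of width M of the coins⟩`, `i < 31K` (`Khot.gOf`), as a list.
[cite: Khot2005, Lemma 4.3] -/
def gL : List ℕ := (List.range (31 * g.K)).map fun i => bitsToNat (block (MM g.u g.σ g.K k) g.c i)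

/-- The lifted random row `r`: entry `i < rows` is block `i` of width `lq` after the first `Lg` coins,
reduced modulo `q₂` (`liftRow (Khot.rOf c)`), as a list. [cite: Khot2005, §5.2.2] -/
def rL : List ℤ := (List.range (rows g.u g.σ g.K k)).map fun i =>
  ((bitsToNat (block (lq g.u g.σ g.K k) (g.c.drop (Lg g.u g.σ g.K k)) i) % q₂ g.u g.σ g.K k : ℕ) : ℤ)

/-- The BCH block (`khotBCHTab`). [cite: Khot2005, Thm. 4.1] -/
def Ptab : List (List ℤ) := khotBCHTab g.u g.σ g.K k

/-- The sampled shift `s'` (`shiftL`). [cite: Khot2005, Lemma 4.3] -/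
def sL : List ℤ := shiftL (hh g.u g.σ g.K k) (NN g.u g.σ g.K k) (Ptab k g) (gL k g)

/-- The base basis `B₀` (`baseTab`; `Q = D = DD`, modulus `q₂`). [cite: Khot2005, §5.2.2 (Fig. 4)] -/
def B0 : List (List ℤ) :=
  baseTab g.u g.σ (hh g.u g.σ g.K k) (NN g.u g.σ g.K k) g.sets (Ptab k g) (sL k g) (DD g.u g.σ g.K k) (DD g.u g.σ g.K k)
    (q₂ g.u g.σ g.K k) (rL k g)

/-- The scaling `W = s^k`. [cite: Khot2005, §7 Eq. (2)] -/
def W : ℤ := ((ss g.u g.σ g.K k ^ k : ℕ) : ℤ)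

/-- The base distortion constant `c₁ = rows · D · (4σ + 3N + 5) + 1` (`baseC₁`). [folklore] -/
def c₁ : ℤ := ((rows g.u g.σ g.K k * DD g.u g.σ g.K k * (4 * g.σ + 3 * NN g.u g.σ g.K k + 5) + 1 : ℕ) : ℤ)

/-- The padding constant `Kpad = D + growth · (c₁ · D) + 1`. [folklore] -/
def Kpad : ℤ :=
  (DD g.u g.σ g.K k : ℤ) + growthL (outCard (rows g.u g.σ g.K k + 1) (cols g.u g.σ g.K k) k) (cols g.u g.σ g.K k ^ (k + 1))
    (augPowTab (rows g.u g.σ g.K k + 1) (cols g.u g.σ g.K k) (B0 k g) (W k g) k) * (c₁ k g * (DD g.u g.σ g.K k : ℤ)) + 1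

/-- The output table (`outTab`). [cite: Khot2005, §7.3] -/
def T : List (List ℤ) := outTab (rows g.u g.σ g.K k + 1) (cols g.u g.σ g.K k) (g.u - 1) (B0 k g) (W k g) (Kpad k g) k

/-- The output dimension `N_f = outCard (rows+1) cols k` (`NfExplicit`). [cite: Khot2005, §7.3] -/
def Nf : ℕ := outCard (rows g.u g.σ g.K k + 1) (cols g.u g.σ g.K k) k

/-- The row-major list of the output table. [cite: AroraBarak2009, §0.1] -/
def rowMajor : List ℤ := (List.range (Nf k g * Nf k g)).map fun m => ent (T k g) (m / Nf k g) (m % Nf k g)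

/-- **The output of the main branch, typed**: `((N_f, row-major basis), (τ, 1))`. [cite: Khot2005, §7.3] -/
def mainOut : (ℕ × List ℤ) × (ℤ × ℕ) := ((Nf k g, rowMajor k g), ((tauN g.u g.σ g.K k : ℤ), 1))

/-- The code of a typed output: `⟨⟨n, listE of sign–magnitude entries⟩, ⟨num, den⟩⟩` (the format of
`GapSVPInstance.encode`). [cite: AroraBarak2009, §0.1] -/
abbrev outE : (ℕ × List ℤ) × (ℤ × ℕ) → List Bool := pairE (pairE natE (listE smE)) (pairE smE natE)

end MainProgram

/-! ### The main branch is polynomial-time -/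

section MainFP

variable (k : ℕ)

/-- The typed view on the guard. [folklore] -/
theorem gTupFP : CodeFP gE tE (fun g => tupOf g.val) := tupOfFP.subtype

/-- The size datum on the guard. [folklore] -/
theorem pdFP : CodeFP gE pdE GIn.pd := by
  have hT := gTupFP
  have hcode : CodeFP gE strE (fun g => SetCoverInstance.encoding.encode g.I) :=
    of_fn Brick.fstF Brick.fstF_mem_FP fun g => by simp [gE, inE, strE]
  have hn : CodeFP gE unE GIn.n := (strLength.comp hcode :)
  have hu : CodeFP gE natE GIn.u := (hT.fst'.fst' :)
  have hK : CodeFP gE natE GIn.K := (hT.fst'.snd'.snd' :)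
  have hσ' := ((natLength _).comp ((rawOfList (listE natE)).comp hT.fst'.snd'.fst') :)
  have hσ : CodeFP gE natE GIn.σ := hσ'.congr fun p => by simp [tupOf]
  have h := (hn.pair (hu.pair (hσ.pair hK)) :)
  exact h.congr fun _ => rfl

/-- The sets, raw. [folklore] -/
theorem setsFP : CodeFP gE (rawE (rawE natE)) GIn.sets := by
  have h := ((map₀ (rawOfList natE)).comp ((rawOfList (listE natE)).comp gTupFP.fst'.snd'.fst') :)
  exact h.congr fun p => by simp [tupOf]

/-- The coins. [folklore] -/
theorem cFP : CodeFP gE strE GIn.c := gTupFP.snd'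

/-- The sampled columns on codes. [cite: Khot2005, Lemma 4.3; AroraBarak2009, §1.3] -/
theorem gLFP : CodeFP gE (rawE natE) (gL k) := by
  have hch : CodeFP gE (rawE strE) (fun g => (List.range (31 * g.K)).map fun i => (g.c.drop (i * MM g.u g.σ g.K k)).take
      (MM g.u g.σ g.K k)) := (strChunks.comp (((PDom.cKunFP 31).comp pdFP).pair (((MMunFP k).comp pdFP).pair cFP)) :)
  have h := ((map₀ strVal).comp hch :)
  exact h.congr fun _ => by simp [gL, block]

/-- The lifted random row on codes. [cite: Khot2005, §5.2.2; AroraBarak2009, §1.3] -/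
theorem rLFP : CodeFP gE (rawE intE) (rL k) := by
  have hdrop : CodeFP gE strE (fun g => g.c.drop (Lg g.u g.σ g.K k)) := (strDrop.comp (((LgunFP k).comp pdFP).pair cFP) :)
  have hch : CodeFP gE (rawE strE) (fun g => (List.range (rows g.u g.σ g.K k)).map fun i =>
      ((g.c.drop (Lg g.u g.σ g.K k)).drop (i * lq g.u g.σ g.K k)).take (lq g.u g.σ g.K k)) :=
    (strChunks.comp (((rowsunFP k).comp pdFP).pair (((lqunFP k).comp pdFP).pair hdrop)) :)
  have hitem : CodeFP (pairE natE strE) intE (fun t => ((bitsToNat t.2 % t.1 : ℕ) : ℤ)) :=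
    (intOfNat.comp (natMod.comp ((strVal.comp (snd _ _)).pair (fst _ _))) :)
  have h := ((map hitem).comp (((q₂FP k).comp pdFP).pair hch) :)
  exact h.congr fun _ => by simp [rL, block]

/-- The BCH block on codes (`khotBCHTabFP`). [cite: Khot2005, Thm. 4.1] -/
theorem PtabFP : CodeFP gE matE (Ptab k) := by
  have h := (khotBCHTabFP.comp ((PDom.KunFP.comp pdFP).pair (((MMunFP k).comp pdFP).pair ((NNunFP k).comp pdFP))) :)
  exact h.congr fun _ => rfl

/-- The sampled shift on codes. [cite: Khot2005, Lemma 4.3] -/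
theorem sLFP : CodeFP gE (rawE intE) (sL k) := by
  have h := (shiftLFP.comp ((((hhunFP k).comp pdFP).pair ((NNunFP k).comp pdFP)).pair ((PtabFP k).pair (gLFP k))) :)
  exact h.congr fun _ => rfl

/-- `D = DD` as an integer. [folklore] -/
theorem DDintFP : CodeFP gE intE (fun g => (DD g.u g.σ g.K k : ℤ)) := by
  have h := (intOfNat.comp ((DDFP k).comp pdFP) :)
  exact h.congr fun _ => rfl

/-- The base basis on codes. [cite: Khot2005, §5.2.2 (Fig. 4); AroraBarak2009, §1.3] -/
theorem B0FP : CodeFP gE matE (B0 k) := by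
  have hp := pdFP
  have hctx : CodeFP gE intCtxE (fun g => ((g.u, (g.σ, (hh g.u g.σ g.K k, NN g.u g.σ g.K k))),
      ((g.sets, (Ptab k g, sL k g)), (DD g.u g.σ g.K k : ℤ)))) :=
    (((PDom.uFP.comp hp).pair ((PDom.σFP.comp hp).pair (((hhFP k).comp hp).pair ((NNFP k).comp hp)))).pair
      ((setsFP.pair ((PtabFP k).pair (sLFP k))).pair (DDintFP k)) :)
  have hb : CodeFP gE baseCtxE (fun g => ((rows g.u g.σ g.K k, ((g.u, (g.σ, (hh g.u g.σ g.K k, NN g.u g.σ g.K k))),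
      ((g.sets, (Ptab k g, sL k g)), (DD g.u g.σ g.K k : ℤ)))),
      ((DD g.u g.σ g.K k : ℤ), ((q₂ g.u g.σ g.K k : ℤ), rL k g)))) :=
    ((((rowsunFP k).comp hp).pair hctx).pair ((DDintFP k).pair ((intOfNat.comp ((q₂FP k).comp hp)).pair (rLFP k))) :)
  -- the dimensions, written exactly as in `baseTab`: `(u+σ+h+N) + 1` and `σ + N + h + 1 + 1`
  have hdims : CodeFP gE (pairE unE unE) (fun g => (rows g.u g.σ g.K k + 1,
      g.σ + NN g.u g.σ g.K k + hh g.u g.σ g.K k + 1 + 1)) :=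
    ((unSucc.comp ((rowsunFP k).comp hp)).pair (unSucc.comp (unSucc.comp (unAdd.comp ((unAdd.comp
      ((PDom.σunFP.comp hp).pair ((NNunFP k).comp hp))).pair ((hhunFP k).comp hp))))) :)
  have h := (baseTabFP.comp (hb.pair hdims) :)
  exact h.congr fun _ => rfl

/-- `W` on codes. [cite: Khot2005, §7 Eq. (2)] -/
theorem WintFP : CodeFP gE intE (W k) := by
  have h := (intOfNat.comp ((WFP k).comp pdFP) :)
  exact h.congr fun _ => rfl

/-- `Kpad` on codes. [folklore] -/
theorem KpadFP : CodeFP gE intE (Kpad k) := by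
  have hp := pdFP
  have hσ4 : CodeFP gE natE (fun g => 4 * g.σ) := ((natMulC 4).comp (PDom.σFP.comp hp) :)
  have hc₁' := (intOfNat.comp (natAdd.comp ((natMul.comp ((natMul.comp (((rowsFP k).comp hp).pair ((DDFP k).comp hp))).pair
      (natAdd.comp ((natAdd.comp (hσ4.pair ((natMulC 3).comp ((NNFP k).comp hp)))).pair (const _ 5))))).pair (const _ 1))) :)
  have hc₁ : CodeFP gE intE (c₁ k) := hc₁'.congr fun _ => rfl
  have hr1 : CodeFP gE unE (fun g => rows g.u g.σ g.K k + 1) := (unSucc.comp ((rowsunFP k).comp hp) :)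
  have hcols : CodeFP gE unE (fun g => cols g.u g.σ g.K k) := ((colsunFP k).comp hp :)
  have hA : CodeFP gE matE (fun g => augPowTab (rows g.u g.σ g.K k + 1) (cols g.u g.σ g.K k) (B0 k g) (W k g) k) :=
    ((augPowTabFP k).comp ((hr1.pair hcols).pair ((B0FP k).pair (WintFP k))) :)
  have hgr : CodeFP gE intE (fun g => growthL (outCard (rows g.u g.σ g.K k + 1) (cols g.u g.σ g.K k) k)
      (cols g.u g.σ g.K k ^ (k + 1)) (augPowTab (rows g.u g.σ g.K k + 1) (cols g.u g.σ g.K k) (B0 k g) (W k g) k)) :=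
    (growthLFP.comp ((((outCardFP k).comp (hr1.pair hcols)).pair ((unPowC (k + 1)).comp hcols)).pair hA) :)
  have h := (intAdd.comp ((intAdd.comp ((DDintFP k).pair (intMul.comp (hgr.pair (intMul.comp (hc₁.pair (DDintFP k))))))).pair
    (const _ (1 : ℤ))) :)
  exact h.congr fun g => rfl

/-- The output table on codes. [cite: Khot2005, §7.3; AroraBarak2009, §1.3] -/
theorem TFP : CodeFP gE matE (T k) := by
  have hp := pdFP
  have hu1 : CodeFP gE unE (fun g => g.u - 1) :=
    unOfNat_of_le (natSub.comp ((PDom.uFP.comp hp).pair (const _ 1))) (PDom.nFP.comp hp) fun g =>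
      (Nat.sub_le _ _).trans g.pd.u_le_n
  have hdims : CodeFP gE (pairE unE (pairE unE unE)) (fun g => (rows g.u g.σ g.K k + 1, (cols g.u g.σ g.K k, g.u - 1))) :=
    ((unSucc.comp ((rowsunFP k).comp hp)).pair (((colsunFP k).comp hp).pair hu1) :)
  have h := ((outTabFP k).comp (hdims.pair ((B0FP k).pair ((WintFP k).pair (KpadFP k)))) :)
  exact h.congr fun _ => rfl

/-- `N_f` in unary. [folklore] -/
theorem NfunFP : CodeFP gE unE (Nf k) := by
  have h := ((outCardFP k).comp ((unSucc.comp ((rowsunFP k).comp pdFP)).pair ((colsunFP k).comp pdFP)) :)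
  exact h.congr fun _ => rfl

/-- **The main branch on codes.** [cite: Khot2005, §7.3; AroraBarak2009, §1.3] -/
theorem mainOutFP : CodeFP gE outE (mainOut k) := by
  have hN := NfunFP k
  have hNb : CodeFP gE natE (Nf k) := (natOfUn.comp hN :)
  have hitem : CodeFP (pairE (pairE matE natE) natE) intE (fun t => ent t.1.1 (t.2 / t.1.2) (t.2 % t.1.2)) :=
    (entFP.comp ((fst _ _).fst'.pair ((natDiv.comp ((snd _ _).pair (fst _ _).snd')).pair
      (natMod.comp ((snd _ _).pair (fst _ _).snd')))) :)
  have hrm' := ((map hitem).comp (((TFP k).pair hNb).pair (urange.comp (unMul.comp (hN.pair hN)))) :)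
  have hrm : CodeFP gE (rawE intE) (rowMajor k) := hrm'.congr fun _ => rfl
  have hrmE' := ((listOfRaw smE).comp ((map₀ smOfInt).comp hrm) :)
  have hrmE : CodeFP gE (listE smE) (rowMajor k) := hrmE'.congr fun _ => by simp
  have hτ' := (smOfInt.comp (intOfNat.comp ((tauNFP k).comp pdFP)) :)
  have hτ : CodeFP gE smE (fun g => (tauN g.u g.σ g.K k : ℤ)) := hτ'.congr fun _ => rfl
  have h1 : CodeFP gE natE (fun _ => (1 : ℕ)) := const _ 1
  have h := ((hNb.pair hrmE).pair (hτ.pair h1) :)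
  exact h.congr fun _ => rfl

end MainFP

/-! ### The main branch computes `code (khotMain …)` -/

section MainCorrect

variable (k : ℕ) (g : GIn)

/-- The base basis of the reduction on the input `g` (the `B₀` of `khotInstance` inside `khotMain`).
[cite: Khot2005, §5.2.2 (Fig. 4)] -/
noncomputable abbrev B₀mat : Matrix (RowsT g.u g.σ g.K k ⊕ Unit) (ColsT g.u g.σ g.K k) ℤ :=
  baseBasis (DD g.u g.σ g.K k : ℤ) (setSystem g.I) (khotBCH g.u g.σ g.K k)
    (tupleShift (khotBCH g.u g.σ g.K k) (gOf g.u g.σ g.K k g.c)) (liftRow (rOf g.u g.σ g.K k g.c))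
    (DD g.u g.σ g.K k : ℤ) (q₂ g.u g.σ g.K k)

/-- The sampled columns listed are the values of `gOf`. [cite: Khot2005, Lemma 4.3] -/
theorem mem_gL_iff (nc : Fin (NN g.u g.σ g.K k)) : (nc : ℕ) ∈ gL k g ↔ ∃ i, gOf g.u g.σ g.K k g.c i = nc := by
  simp only [gL, List.mem_map, List.mem_range, gOf]
  constructor
  · rintro ⟨i, hi, hinc⟩
    exact ⟨⟨i, hi⟩, Fin.ext hinc⟩
  · rintro ⟨i, hi⟩
    exact ⟨i, i.isLt, by rw [← hi]⟩

/-- The listed row `rL` lifts `rOf`. [cite: Khot2005, §5.2.2] -/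
theorem getD_rL (x : RowsT g.u g.σ g.K k) :
    (rL k g).getD (idxR g.u g.σ g.K k x) 0 = (((rOf g.u g.σ g.K k g.c x).val : ℕ) : ℤ) := by
  have hx : (idxR g.u g.σ g.K k x : ℕ) < rows g.u g.σ g.K k := (idxR g.u g.σ g.K k x).isLt
  unfold rL
  rw [getD_map_range _ hx, rOf, ZMod.val_natCast]

/-- **The base table holds the base basis.** [cite: Khot2005, §5.2.2 (Fig. 4)] -/
theorem ent_B0 (p : RowsT g.u g.σ g.K k ⊕ Unit) (i : ColsT g.u g.σ g.K k) :
    ent (B0 k g) (rowsUnitEquivFin g.u g.σ g.K k p) (colsEquivFin g.u g.σ g.K k i) = B₀mat k g p i := by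
  unfold B0 Ptab sL
  have hP : ∀ (a : Fin (20 * g.K)) (b : Fin (MM g.u g.σ g.K k + 1)) (nc : Fin (NN g.u g.σ g.K k)),
      ent (khotBCHTab g.u g.σ g.K k) ((b : ℕ) + (MM g.u g.σ g.K k + 1) * a) nc = khotBCH g.u g.σ g.K k (a, b) nc :=
    ent_khotBCHTab g.u g.σ g.K k
  exact ent_baseTab (fun j e => mem_setSystem g.I j e) hP
    (fun a b => getD_shiftL hP (gOf g.u g.σ g.K k g.c) (mem_gL_iff k g) a b) (getD_rL k g) p i

/-- `c₁` is the base distortion constant `baseC₁`. [folklore] -/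
theorem c₁_eq : c₁ k g = baseC₁ (Fin g.u) (Fin g.σ) (Fin (20 * g.K) × Fin (MM g.u g.σ g.K k + 1)) (Fin (NN g.u g.σ g.K k))
    (DD g.u g.σ g.K k : ℤ) := by
  unfold c₁ baseC₁
  rw [card_RowsT]
  simp only [Fintype.card_fin]
  push_cast
  ring

/-- `Kpad` is the padding constant of `khotInstance`. [folklore] -/
theorem Kpad_eq : Kpad k g = (DD g.u g.σ g.K k : ℤ) + growth (augPowMatrix (B₀mat k g) (W k g) k) *
    (baseC₁ (Fin g.u) (Fin g.σ) (Fin (20 * g.K) × Fin (MM g.u g.σ g.K k + 1)) (Fin (NN g.u g.σ g.K k)) (DD g.u g.σ g.K k : ℤ) *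
      (DD g.u g.σ g.K k : ℤ)) + 1 := by
  unfold Kpad
  rw [growthL_augPowTab (rowsUnitEquivFin g.u g.σ g.K k) (colsEquivFin g.u g.σ g.K k) (B₀mat k g) (B0 k g) (ent_B0 k g),
    c₁_eq]

/-- `khotMain` unfolded on an input on the guard. [cite: Khot2005, Thm. 5.1 and §7.3] -/
theorem khotMain_unfold : khotMain k (khotDataExplicit k) g.u g.σ g.K g.one_le_u (setSystem g.I) g.c =
    (columnInstance (squareOf (outMatrix (B₀mat k g) (W k g) k
      (basePad (S := Fin g.σ) (H := Fin (20 * g.K) × Fin (MM g.u g.σ g.K k + 1)) (Nn := Fin (NN g.u g.σ g.K k))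
        (⟨0, g.one_le_u⟩ : Fin g.u))
      ((DD g.u g.σ g.K k : ℤ) + growth (augPowMatrix (B₀mat k g) (W k g) k) *
        (baseC₁ (Fin g.u) (Fin g.σ) (Fin (20 * g.K) × Fin (MM g.u g.σ g.K k + 1)) (Fin (NN g.u g.σ g.K k)) (DD g.u g.σ g.K k : ℤ) *
          (DD g.u g.σ g.K k : ℤ)) + 1))
      ((khotDataExplicit k).eR g.u g.σ g.K) ((khotDataExplicit k).eC g.u g.σ g.K g.one_le_u)), (tauN g.u g.σ g.K k : ℚ)) := by
  simp only [khotMain, khotInstance, coinDecode, W, B₀mat]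
  rfl

/-- **The output instance of `khotMain` is the table (dimension `N_f`) with the threshold `tauN`.**
[cite: Khot2005, §7.3] -/
theorem khotMain_eq_T : khotMain k (khotDataExplicit k) g.u g.σ g.K g.one_le_u (setSystem g.I) g.c =
    (⟨Nf k g, toMat (Nf k g) (Nf k g) (T k g)⟩, (tauN g.u g.σ g.K k : ℚ)) := by
  have h : toMat (Nf k g) (Nf k g) (T k g) = _ :=
    toMat_outTab_explicit g.σ g.K k g.one_le_u (B₀mat k g) (B0 k g) (ent_B0 k g) (W k g) (Kpad k g)
  rw [khotMain_unfold, ← Kpad_eq, h]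
  rfl

/-- `ofFn` over `Fin n` of a function of the value is a `map` over `range n`. [folklore] -/
theorem ofFn_eq_map_range {α : Type} {n : ℕ} (f : ℕ → α) : (List.ofFn fun m : Fin n => f m) = (List.range n).map f := by
  apply List.ext_getElem <;> simp

/-- **The code of the matrix of a table is the `listE` code of its row-major list.** [cite: AroraBarak2009, §0.1] -/
theorem encode_toMat (N : ℕ) (X : List (List ℤ)) :
    (encodingIntMatrixFin N).encode (toMat N N X) = listE smE ((List.range (N * N)).map fun m => ent X (m / N) (m % N)) := by
  rw [← ofFn_eq_map_range]
  show encodingIntBool.listBool.encode _ = _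
  rw [listE_eq]
  rfl

/-- The code of a `GapSVP` instance, unfolded. [cite: MicciancioGoldwasser2002, Ch. 1 §1.2] -/
theorem encode_gapSVP_pair (L : LatticeInstance) (d : ℚ) : GapSVPInstance.encode (L, d) =
    boolPair (boolPair (encodeNat L.n) ((encodingIntMatrixFin L.n).encode L.basis)) (boolPair (smE d.num) (encodeNat d.den)) :=
  rfl

/-- **The main branch computes the code of Khot's instance.** [cite: Khot2005, §7.3] -/
theorem outE_mainOut : outE (mainOut k g) =
    GapSVPInstance.encode (khotMain k (khotDataExplicit k) g.u g.σ g.K g.one_le_u (setSystem g.I) g.c) := by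
  rw [khotMain_eq_T, encode_gapSVP_pair, encode_toMat, Rat.num_natCast, Rat.den_natCast]
  rfl

end MainCorrect

/-! ### The machine and the target fact from PCP alone -/

section Final

/-- **Khot's explicit output map is polynomial-time** (§7.3: "a (randomized) reduction … that runs
in time `n^{O(k²)}`", on the tree's TM2 model): for every number `k` of levels, some `F ∈ FP`
computes `⟨code I, c⟩ ↦ code (khotOutputExplicit k I c)` — the machine hypothesis of
`gapSVP_const_isNPHardRandomized_of_prop6_of_FP_explicit`. [cite: Khot2005, Thm. 1.1 and §7.3] -/
theorem khotOutputExplicit_mem_FP (k : ℕ) : ∃ F : List Bool → List Bool, F ∈ FP ∧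
    ∀ (I : SetCoverInstance) (c : List Bool),
      F (boolPair (SetCoverInstance.encoding.encode I) c) = GapSVPInstance.encode (khotOutputExplicit k I c) := by
  classical
  obtain ⟨C, hC, hCg⟩ := guardBitFP
  obtain ⟨Y, hY, hYg⟩ := yesBitFP
  obtain ⟨M, hM, hMg⟩ := mainOutFP k
  refine ⟨iteFn C M (iteFn Y (fun _ => GapSVPInstance.encode fixedYes)
      (fun _ => GapSVPInstance.encode (fixedNoPow k))),
    iteFn_mem_FP hC hM (iteFn_mem_FP hY (const_mem_FP _) (const_mem_FP _)), fun I c => ?_⟩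
  have hin : boolPair (SetCoverInstance.encoding.encode I) c = inE (I, c) := rfl
  rw [hin]
  unfold khotOutputExplicit khotOutput
  by_cases hG : Guard I
  · have hbit : C (inE (I, c)) = [true] := by
      rw [hCg]
      simp only [bitE]
      rw [(guardBit_iff I).2 hG]
    rw [iteFn_apply_true hbit, dif_pos hG]
    have hM' := hMg ⟨(I, c), hG⟩
    rw [gE] at hM'
    rw [hM']
    exact outE_mainOut k ⟨(I, c), hG⟩
  · have hbit : C (inE (I, c)) = [false] := by
      have : guardBit I.univSize I.sets I.K = false := by
        rw [Bool.eq_false_iff]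
        exact fun h => hG ((guardBit_iff I).1 h)
      rw [hCg]
      simp only [bitE]
      rw [this]
    rw [iteFn_apply_false hbit, dif_neg hG, iteFn_apply (b := decide (I.univSize = 0 ∧ 1 ≤ I.K ∧ I.K ≤ I.sets.length))
      (by rw [hYg]; rfl)]
    by_cases h2 : I.univSize = 0 ∧ 1 ≤ I.K ∧ I.K ≤ I.sets.length
    · rw [if_pos h2, decide_eq_true h2, if_pos rfl]
    · rw [if_neg h2, decide_eq_false h2]
      rfl

/-- **Khot 2005, Thm. 1.1 (`p = 2`, first assertion) from the PCP-based gap set cover hardness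
alone**: the named fact `gapSVP_const_isNPHardRandomized` (`LatticeComplexity.lean`, pqc.S17)
follows from Arora–Babai–Stern–Sweedyk 1997, Prop. 6 (`AroraEtAl1997_prop6`; BGLR 1993 + the PCP
theorem) — every other ingredient of Khot's randomised reduction (Thm. 3.1, Thm. 4.1, Lemmas
4.2–4.3, Thm. 5.1 with Lemmas 5.4–5.8, §6–7, the parameter choice of §7.3, the coin model, and now
the polynomial-time machine for the map) is proved in the tree. [cite: Khot2005, Thm. 1.1; AroraEtAl1997, Prop. 6 (p. 319)] -/
theorem gapSVP_const_isNPHardRandomized_of_prop6 (h₁ : AroraEtAl1997_prop6) : gapSVP_const_isNPHardRandomized :=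
  gapSVP_const_isNPHardRandomized_of_prop6_of_FP_explicit h₁ khotOutputExplicit_mem_FP

/-- Pointwise form: under `AroraEtAl1997_prop6`, `GapSVP_{γ₀}` is NP-hard under randomised reductions
for every constant `γ₀ ≥ 1`. [cite: Khot2005, Thm. 1.1] -/
theorem isNPHardRandomized_gapSVP_of_prop6 (h₁ : AroraEtAl1997_prop6) {γ₀ : ℝ} (hγ₀ : 1 ≤ γ₀) :
    (gapSVPPromise fun _ => γ₀).IsNPHardRandomized := by
  obtain ⟨k, hk⟩ := exists_levels γ₀
  obtain ⟨F, hF, hFI⟩ := khotOutputExplicit_mem_FP k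
  exact isNPHardRandomized_gapSVP_of_prop6_of_FP_explicit h₁ hγ₀ hk hF hFI

end Final

end Literature.Algebra.EuclideanLattices.Khot
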